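import Literature.Geometry.Lorentzian.CoordGaussianSlice
import HarnessLib

/-!
# The Codazzi equation of a coordinate slice in second-order Gaussian form

Companion of `CoordGaussianSlice.lean` (coordinate tensor calculus `MetricCoord` on
`E = ℝ × F`: metric components `G`, the slice `Σ = {0} × B` of a `G` Gaussian to second order
along `Σ` (`IsGaussianSlice G B`), induced metric `h = sliceMetric G`, second fundamental form
`K = sliceK G`, time vector `e₀ = tvec`, spatial vectors `ṽ = svec v`). That file proves, at the
points of `Σ`, the **Gauss equation** `G(R(ũ,ṽ)w̃, z̃) = h(R_h(u,v)w, z) + K(v,w)K(u,z) − K(u,w)K(v,z)`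
(`apply_riemAt_svec`) and the normal component `G(R(e₀,ṽ)w̃, e₀)` (`apply_riemAt_tvec`). This
file completes the Gauss–Codazzi pair with the **Codazzi equation**: the components of the
curvature endomorphism `R = riemAt G` with exactly one time slot, as polynomials in
`∂K = fderiv ℝ (sliceK G) y`, `K` and the Christoffel map `Γ_h = chrAt (sliceMetric G) y` of the
slice metric,

* `apply_riemAt_svec_svec_svec_tvec` —
  `G(R(ũ,ṽ)w̃, e₀) = ∂_v K(u,w) − ∂_u K(v,w) − K(u, Γ_h(v,w)) + K(v, Γ_h(u,w))`
  `= (∇ʰ_v K)(u,w) − (∇ʰ_u K)(v,w)` (`apply_riemAt_svec_svec_svec_tvec_eq_sub`), where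
  `(∇ʰ_u K)(v,w) = ∂_u K(v,w) − K(Γ_h(u,v), w) − K(v, Γ_h(u,w))` is the covariant derivative of
  `K` for `h` in coordinates. This is O'Neill 1983, Ch. 4, Prop. 4.33,
  `nor R̄_{VW}X = −(∇_V II)(W,X) + (∇_W II)(V,X)`, read with O'Neill's `R̄_{VW} = −R(V,W)`
  (the convention note of `MetricCoord.riemAt`), the shape tensor `II(ṽ,w̃) = K(v,w) e₀`
  (`chrAt_svec_svec`) whose normal covariant derivative is `(∇ʰK) e₀` (`Γ(ṽ,e₀)` is tangent,
  `chrAt_svec_tvec`), and `G(e₀,e₀) = −1`;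
* `apply_riemAt_tvec_svec_svec_svec` — the other placement
  `G(R(e₀,ṽ)w̃, z̃) = (∇ʰ_w K)(z,v) − (∇ʰ_z K)(w,v)`, from the first by the pair symmetry
  `IsMetricOn.apply_riemAt_pair_comm` and skew-adjointness `IsMetricOn.apply_riemAt_swap` of
  `CoordCurvature.lean`;
* `apply_riemAt_svec_svec_tvec_svec`, `apply_riemAt_svec_tvec_svec_svec` — the remaining two
  single-time placements, reduced to the previous ones by the two skew-symmetries.

On the way: the tangential second derivatives `D²G(ṽ)(ũ)(e₀, w̃) = 0` along `Σ`
(`fderiv₂_svec_svec_tvec_svec`), the tangential derivative of the Koszul form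
`∂_ũ K_G(ṽ,w̃,e₀) = −2 ∂_u K(v,w)` and the pairing `G(Γ(ṽ,w̃), Γ(ũ,e₀)) = K(u, Γ_h(v,w))`.
Everything is by the first-kind curvature formula `IsMetricOn.apply_riemAt`; everything is
proved; no definition, no statement of `Prop` type is introduced. The contracted form
`D_a K^a_b − D_b K^a_a = R_{cd} n^d h^c_b` (Wald 1984, (10.2.24), the momentum constraint) is not
restated here.

## References

* B. O'Neill, *Semi-Riemannian geometry with applications to relativity*, Academic Press 1983,
  Ch. 3, Prop. 3.36 (symmetries of curvature); Ch. 4, Prop. 4.33 (Codazzi equation) and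
  Cor. 4.34. [ONeill1983]
* R. M. Wald, *General Relativity*, Chicago 1984, §3.3 (Gaussian normal coordinates), §10.2,
  (10.2.13), (10.2.23)–(10.2.24) (Gauss–Codazzi relations). [Wald1984]
-/

noncomputable section

-- instance search on the nested operator spaces `(ℝ × F) →L[ℝ] (ℝ × F) →L[ℝ] (ℝ × F) →L[ℝ] ℝ`
-- (second derivatives of the metric components) needs one more level of pending depth.
set_option maxSynthPendingDepth 3

open Set Filter ContinuousLinearMap Module
open scoped Topology ContDiff

namespace Literature.Geometry.Lorentzian

namespace MetricCoord

namespace GaussSlice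

variable {F : Type*} [NormedAddCommGroup F] [NormedSpace ℝ F]
  {G : ℝ × F → (ℝ × F) →L[ℝ] (ℝ × F) →L[ℝ] ℝ} {T : Set (ℝ × F)} {B : Set F} {y : F}

/-! ### Second order along the slice: the mixed components -/

section SecondOrder

variable (hG : IsMetricOn G T) (hS : IsGaussianSlice G B)
include hG hS

/-- **`D²G(ṽ)(ũ)(e₀, w̃) = 0` on the slice**: `G(e₀, w̃) = 0` all along `Σ`, so its first
tangential derivatives `DG(ũ)(e₀, w̃)` vanish on `Σ` (`fderiv_svec_tvec_svec`), hence so do their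
tangential derivatives. [cite: Wald1984, §3.3] -/
theorem fderiv₂_svec_svec_tvec_svec (hB : IsOpen B) (hBT : ∀ y ∈ B, svec y ∈ T) (hy : y ∈ B)
    (v u w : F) : fderiv ℝ (fderiv ℝ G) (svec y) (svec v) (svec u) tvec (svec w) = 0 := by
  rw [← fderiv_slice_fderiv_apply₃ hG hBT hy,
    fderiv_eq_zero_of_eqOn_const hB (c := (0 : ℝ))
      (fun y' hy' ↦ fderiv_svec_tvec_svec hG hS hB hBT hy' u w) hy]
  rfl

/-- `D²G(ṽ)(ũ)(w̃, e₀) = 0` on the slice. [cite: Wald1984, §3.3] -/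
theorem fderiv₂_svec_svec_svec_tvec (hB : IsOpen B) (hBT : ∀ y ∈ B, svec y ∈ T) (hy : y ∈ B)
    (v u w : F) : fderiv ℝ (fderiv ℝ G) (svec y) (svec v) (svec u) (svec w) tvec = 0 := by
  rw [hG.fderiv_fderiv_symm (hBT y hy), fderiv₂_svec_svec_tvec_svec hG hS hB hBT hy]

/-- **`∂_ũ K_G(ṽ, w̃, e₀) = −2 ∂_u K(v, w)` on the slice** (`K_G` the Koszul form of `G`,
`K = sliceK G`): of the three second derivatives in `∂_ũ K_G(ṽ,w̃,e₀)` the two with a tangentially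
differentiated `G(·, e₀)` vanish and `D²G(ũ)(e₀)(ṽ,w̃) = 2 ∂_u K(v,w)`.
[cite: Wald1984, (10.2.13)] -/
theorem fderiv_svec_koszulCLM_svec_svec_tvec (hB : IsOpen B) (hBT : ∀ y ∈ B, svec y ∈ T)
    (hy : y ∈ B) (u v w : F) :
    fderiv ℝ (fun x ↦ koszulCLM G x (svec v) (svec w) tvec) (svec y) (svec u) =
      -(2 * fderiv ℝ (sliceK G) y u v w) := by
  rw [hG.fderiv_koszulCLM_apply₃ (hBT y hy), fderiv₂_svec_svec_svec_tvec hG hS hB hBT hy,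
    fderiv₂_svec_svec_tvec_svec hG hS hB hBT hy, fderiv₂_svec_tvec_svec_svec hG hBT hy]
  ring

end SecondOrder

/-! ### The Codazzi equation -/

section Codazzi

variable [FiniteDimensional ℝ F] [CompleteSpace F] (hG : IsMetricOn G T) (hS : IsGaussianSlice G B)
include hG hS

omit [CompleteSpace F] in
/-- **`G(Γ(ṽ, w̃), Γ(ũ, e₀)) = K(u, Γ_h(v, w))` on the slice**: `Γ(ṽ,w̃) = K(v,w)e₀ + (Γ_h(v,w))~`
is paired with the tangent vector `Γ(ũ,e₀) = (♯_h K(u,·))~`. [cite: Wald1984, §10.2] -/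
theorem apply_chrAt_svec_svec_chrAt_svec_tvec (hB : IsOpen B) (hBT : ∀ y ∈ B, svec y ∈ T)
    (hy : y ∈ B) (u v w : F) :
    G (svec y) (chrAt G (svec y) (svec v) (svec w)) (chrAt G (svec y) (svec u) tvec) =
      sliceK G y u (chrAt (sliceMetric G) y v w) := by
  have hh := isMetricOn_sliceMetric hG hS hB hBT
  rw [chrAt_svec_svec hG hS hB hBT hy, chrAt_svec_tvec hG hS hB hBT hy, map_add, map_smul,
    _root_.add_apply, _root_.smul_apply, apply_tvec hS hy, apply_svec hG hS hBT hy]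
  dsimp only
  rw [apply_apply_sharpAt (hh.isInvertible y hy) (hh.symm y hy), neg_zero, smul_zero, zero_add]

/-- **The Codazzi equation** on the slice (O'Neill 1983, Ch. 4, Prop. 4.33,
`nor R̄_{VW}X = −(∇_V II)(W,X) + (∇_W II)(V,X)`, with O'Neill's `R̄_{VW} = −R(V,W)`, shape tensor
`II(ṽ,w̃) = K(v,w) e₀` and timelike unit normal `e₀`, `G(e₀,e₀) = −1`):
`G(R(ũ, ṽ)w̃, e₀) = ∂_v K(u,w) − ∂_u K(v,w) − K(u, Γ_h(v,w)) + K(v, Γ_h(u,w))`, i.e.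
`(∇ʰ_v K)(u,w) − (∇ʰ_u K)(v,w)` (`apply_riemAt_svec_svec_svec_tvec_eq_sub`).
[cite: ONeill1983, Ch. 4, Prop. 4.33] -/
theorem apply_riemAt_svec_svec_svec_tvec (hB : IsOpen B) (hBT : ∀ y ∈ B, svec y ∈ T) (hy : y ∈ B)
    (u v w : F) :
    G (svec y) (riemAt G (svec y) (svec u) (svec v) (svec w)) tvec =
      fderiv ℝ (sliceK G) y v u w - fderiv ℝ (sliceK G) y u v w
        - sliceK G y u (chrAt (sliceMetric G) y v w) + sliceK G y v (chrAt (sliceMetric G) y u w) := by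
  rw [hG.apply_riemAt (hBT y hy), fderiv_svec_koszulCLM_svec_svec_tvec hG hS hB hBT hy,
    fderiv_svec_koszulCLM_svec_svec_tvec hG hS hB hBT hy,
    apply_chrAt_svec_svec_chrAt_svec_tvec hG hS hB hBT hy,
    apply_chrAt_svec_svec_chrAt_svec_tvec hG hS hB hBT hy]
  ring

/-- **The Codazzi equation, covariant-derivative form**:
`G(R(ũ, ṽ)w̃, e₀) = (∇ʰ_v K)(u,w) − (∇ʰ_u K)(v,w)` with
`(∇ʰ_u K)(v,w) = ∂_u K(v,w) − K(Γ_h(u,v), w) − K(v, Γ_h(u,w))` written out (the terms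
`K(Γ_h(u,v), w)` cancel by torsion-freeness `Γ_h(u,v) = Γ_h(v,u)`).
[cite: ONeill1983, Ch. 4, Prop. 4.33] -/
theorem apply_riemAt_svec_svec_svec_tvec_eq_sub (hB : IsOpen B) (hBT : ∀ y ∈ B, svec y ∈ T)
    (hy : y ∈ B) (u v w : F) :
    G (svec y) (riemAt G (svec y) (svec u) (svec v) (svec w)) tvec =
      (fderiv ℝ (sliceK G) y v u w - sliceK G y (chrAt (sliceMetric G) y v u) w
          - sliceK G y u (chrAt (sliceMetric G) y v w))
        - (fderiv ℝ (sliceK G) y u v w - sliceK G y (chrAt (sliceMetric G) y u v) w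
          - sliceK G y v (chrAt (sliceMetric G) y u w)) := by
  have hh := isMetricOn_sliceMetric hG hS hB hBT
  rw [apply_riemAt_svec_svec_svec_tvec hG hS hB hBT hy, hh.chrAt_comm hy v u]
  ring

/-- **The Codazzi equation, second placement**:
`G(R(e₀, ṽ)w̃, z̃) = ∂_w K(z,v) − ∂_z K(w,v) + K(w, Γ_h(z,v)) − K(z, Γ_h(w,v))`
`= (∇ʰ_w K)(z,v) − (∇ʰ_z K)(w,v)`, from `apply_riemAt_svec_svec_svec_tvec` by pair symmetry
`G(R(e₀,ṽ)w̃, z̃) = G(R(w̃,z̃)e₀, ṽ)` (O'Neill 1983, Ch. 3, Prop. 3.36 (4)) and skew-adjointness.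
[cite: ONeill1983, Ch. 4, Prop. 4.33] -/
theorem apply_riemAt_tvec_svec_svec_svec (hB : IsOpen B) (hBT : ∀ y ∈ B, svec y ∈ T) (hy : y ∈ B)
    (v w z : F) :
    G (svec y) (riemAt G (svec y) tvec (svec v) (svec w)) (svec z) =
      fderiv ℝ (sliceK G) y w z v - fderiv ℝ (sliceK G) y z w v
        + sliceK G y w (chrAt (sliceMetric G) y z v) - sliceK G y z (chrAt (sliceMetric G) y w v) := by
  have hx := hBT y hy
  rw [hG.apply_riemAt_pair_comm hx, hG.apply_riemAt_swap hx,
    apply_riemAt_svec_svec_svec_tvec hG hS hB hBT hy]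
  ring

omit [FiniteDimensional ℝ F] hS in
/-- `G(R(ũ, ṽ)e₀, z̃) = −G(R(ũ, ṽ)z̃, e₀)` on the slice (skew-adjointness; the right-hand side is
the Codazzi component `apply_riemAt_svec_svec_svec_tvec`). [cite: ONeill1983, Ch. 3, Prop. 3.36 (2)] -/
theorem apply_riemAt_svec_svec_tvec_svec (hBT : ∀ y ∈ B, svec y ∈ T) (hy : y ∈ B) (u v z : F) :
    G (svec y) (riemAt G (svec y) (svec u) (svec v) tvec) (svec z) =
      -G (svec y) (riemAt G (svec y) (svec u) (svec v) (svec z)) tvec :=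
  hG.apply_riemAt_swap (hBT y hy) (svec u) (svec v) (svec z) tvec

omit [FiniteDimensional ℝ F] [CompleteSpace F] hG hS in
/-- `G(R(ũ, e₀)w̃, z̃) = −G(R(e₀, ũ)w̃, z̃)` (skew-symmetry; the right-hand side is the Codazzi
component `apply_riemAt_tvec_svec_svec_svec`). [cite: ONeill1983, Ch. 3, Prop. 3.36 (1)] -/
theorem apply_riemAt_svec_tvec_svec_svec (u w z : F) :
    G (svec y) (riemAt G (svec y) (svec u) tvec (svec w)) (svec z) =
      -G (svec y) (riemAt G (svec y) tvec (svec u) (svec w)) (svec z) := by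
  rw [riemAt_swap G (svec y) tvec (svec u), _root_.neg_apply, map_neg, _root_.neg_apply]

end Codazzi

end GaussSlice

end MetricCoord

end Literature.Geometry.Lorentzian

end
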